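import Mathlib
import HarnessLib

/-!
# The inviscid rung-2 centre law: an exact first integral and finite life from compression or swirl
(Negative/K2 lane bookkeeping, supports `RungBlowupCofinal` / BC5 rung 2; circuit seat g9; companion of
`StrainSectorCentreLaw.lean`, `StrainSectorCentreJet.lean` in this folder)

MODEL, NOT NS (and not Euler).  In the closed strain+swirl sector of the degree-`2` angular Galerkin truncation, at `ν = 0`
the centre strain `s = 3a₀` and centre angular velocity `Ω = b₀` obey the CLOSED pair (`StrainSectorCentreLaw.centreLaw` with
`ν = 0`, exact for every profile; AGL-RUNG2-STRUCTURE §3)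

  `ṡ = −(5/14) s² − (2/5) Ω²`,   `Ω̇ = s Ω`

— Vieillefosse's restricted Euler on the symmetry axis (`ṡ = −½s² − ⅔Ω²`, `Ω̇ = sΩ`;
`Literature/Analysis/FluidPDE/RestrictedEulerDynamics.lean`) with the two strain coefficients renormalised by the exact degree-2
pressure Hessian.  This file proves, for `C¹` solutions `(s, Ω)` on a closed time interval (one-sided derivatives within it):

* `hasDerivWithinAt_firstIntegral`, `firstIntegral_eq` : **`G := Ω² · (s² + (28/95) Ω²)^{14/5}` is an exact first integral**
  (the analogue of restricted Euler's `Q³ + (27/4)R²`; new — the memo had only the Riccati inequality);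
* `swirl_ne_zero` : hence centre swirl never switches off (`Ω(t₁) ≠ 0 ⇒ Ω(t) ≠ 0`) and `strain_antitoneOn` : `s` never increases;
* `time_lt_of_compression` : from axial COMPRESSION `s(t₁) < 0` no classical solution lives past `t₁ + 14/(5|s(t₁)|)`
  (Riccati comparison `d/dt(−1/s) ≤ −5/14`);
* `time_lt_of_swirl` : from ANY datum with `Ω(0) ≠ 0` no classical solution lives past
  `max(0, (s(0)+1)/δ) + 14/5`, `δ = (5/14)·((28/95)·G(0))^{5/19} > 0` (the first integral bounds `s² + (28/95)Ω²` below by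
  `((28/95)G)^{5/19}`, so `ṡ ≤ −δ` uniformly; once `s ≤ −1` the compression clock finishes it).

So the inviscid truncation `Euler₂` has NO global classical solution in this sector unless `Ω(0) = 0 ≤ s(0)` — «truncation more
singular than the truth» (card K2 of route №8) as numbers at `L = 2` (true axisymmetric no-swirl Euler is globally regular for smooth
data).  Nothing here is a statement about the viscous rung (`ν > 0`, crux K1) and nothing asserts a Theses declaration.
-/

namespace Summit.NavierStokesRegularity.RungBlowupCofinalInviscidCentreLaw

open Set Filter Topology

/-! ### §0 One-variable calculus on a closed interval (one-sided derivatives) -/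

/-- Monotonicity from a nonnegative one-sided derivative within `[a, b]`. -/
private theorem icl_monotoneOn_Icc {f f' : ℝ → ℝ} {a b : ℝ}
    (hf : ∀ t ∈ Icc a b, HasDerivWithinAt f (f' t) (Icc a b) t) (hf' : ∀ t ∈ Icc a b, 0 ≤ f' t) :
    MonotoneOn f (Icc a b) := by
  refine monotoneOn_of_hasDerivWithinAt_nonneg (f' := f') (convex_Icc a b)
    (fun t ht => (hf t ht).continuousWithinAt) (fun t ht => ?_) (fun t ht => ?_)
  · exact (hf t (interior_subset ht)).mono interior_subset
  · exact hf' t (interior_subset ht)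

/-- Antitonicity from a nonpositive one-sided derivative within `[a, b]`. -/
private theorem icl_antitoneOn_Icc {f f' : ℝ → ℝ} {a b : ℝ}
    (hf : ∀ t ∈ Icc a b, HasDerivWithinAt f (f' t) (Icc a b) t) (hf' : ∀ t ∈ Icc a b, f' t ≤ 0) :
    AntitoneOn f (Icc a b) := by
  refine antitoneOn_of_hasDerivWithinAt_nonpos (f' := f') (convex_Icc a b)
    (fun t ht => (hf t ht).continuousWithinAt) (fun t ht => ?_) (fun t ht => ?_)
  · exact (hf t (interior_subset ht)).mono interior_subset
  · exact hf' t (interior_subset ht)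

/-- A function with zero one-sided derivative within `[a, b]` is constant there. -/
private theorem icl_eq_of_hasDerivWithinAt_zero {f : ℝ → ℝ} {a b : ℝ}
    (hf : ∀ t ∈ Icc a b, HasDerivWithinAt f 0 (Icc a b) t) {t : ℝ} (ht : t ∈ Icc a b) :
    f t = f a := by
  have ha : a ∈ Icc a b := left_mem_Icc.2 (ht.1.trans ht.2)
  have h1 := icl_monotoneOn_Icc (f' := fun _ => 0) hf (fun _ _ => le_rfl) ha ht ht.1
  have h2 := icl_antitoneOn_Icc (f' := fun _ => 0) hf (fun _ _ => le_rfl) ha ht ht.1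
  exact le_antisymm h2 h1

/-! ### §1 The first integral `G = Ω² (s² + (28/95) Ω²)^{14/5}` -/

/-- **The renormalised discriminant is conserved.**  If at `t` (within the time set `D`)
`ṡ = −(5/14)s² − (2/5)Ω²` and `Ω̇ = sΩ`, then `G(τ) = Ω(τ)² · (s(τ)² + (28/95) Ω(τ)²)^{14/5}` has derivative `0` at `t` within `D`.
(Key identity: `P = s² + (28/95)Ω²` obeys `Ṗ = −(5/7) s P`, while `d/dt Ω² = 2 s Ω²`; the exponent `14/5 ≥ 1` keeps `P^{14/5}`
differentiable at `P = 0`.) -/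
theorem hasDerivWithinAt_firstIntegral {s Ω : ℝ → ℝ} {D : Set ℝ} {t : ℝ}
    (hs : HasDerivWithinAt s (-(5 / 14) * s t ^ 2 - (2 / 5) * Ω t ^ 2) D t)
    (hΩ : HasDerivWithinAt Ω (s t * Ω t) D t) :
    HasDerivWithinAt (fun τ => Ω τ ^ 2 * (s τ ^ 2 + (28 / 95) * Ω τ ^ 2) ^ ((14 / 5 : ℝ))) 0 D t := by
  have hP : HasDerivWithinAt (fun τ => s τ ^ 2 + (28 / 95) * Ω τ ^ 2)
      (2 * s t * (-(5 / 14) * s t ^ 2 - (2 / 5) * Ω t ^ 2) + (28 / 95) * (2 * Ω t * (s t * Ω t))) D t := by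
    have h := (hs.fun_pow 2).fun_add ((hΩ.fun_pow 2).const_mul (28 / 95 : ℝ))
    refine h.congr_deriv ?_
    push_cast
    ring
  have hPr := hP.rpow_const (p := (14 / 5 : ℝ)) (Or.inr (by norm_num))
  have hG := (hΩ.fun_pow 2).fun_mul hPr
  refine hG.congr_deriv ?_
  have hb : 2 * s t * (-(5 / 14) * s t ^ 2 - 2 / 5 * Ω t ^ 2) + 28 / 95 * (2 * Ω t * (s t * Ω t))
      = -(5 / 7) * s t * (s t ^ 2 + 28 / 95 * Ω t ^ 2) := by ring
  by_cases hP0 : s t ^ 2 + (28 / 95) * Ω t ^ 2 = 0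
  · have hΩ0 : Ω t = 0 := by nlinarith [sq_nonneg (s t), sq_nonneg (Ω t)]
    simp [hΩ0]
  · have hsplit : (s t ^ 2 + (28 / 95) * Ω t ^ 2) ^ ((14 / 5 : ℝ) - 1)
        = (s t ^ 2 + (28 / 95) * Ω t ^ 2) ^ ((14 / 5 : ℝ)) / (s t ^ 2 + (28 / 95) * Ω t ^ 2) :=
      Real.rpow_sub_one hP0 _
    set P := s t ^ 2 + (28 / 95) * Ω t ^ 2 with hPdef
    rw [hb, hsplit]
    norm_num
    field_simp
    ring

/-- **Conservation on a closed interval.**  Along a solution on `[a, b]` (one-sided derivatives within `[a, b]`),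
`Ω(t)² (s(t)² + (28/95)Ω(t)²)^{14/5} = Ω(a)² (s(a)² + (28/95)Ω(a)²)^{14/5}`. -/
theorem firstIntegral_eq {s Ω : ℝ → ℝ} {a b : ℝ}
    (hs : ∀ t ∈ Icc a b, HasDerivWithinAt s (-(5 / 14) * s t ^ 2 - (2 / 5) * Ω t ^ 2) (Icc a b) t)
    (hΩ : ∀ t ∈ Icc a b, HasDerivWithinAt Ω (s t * Ω t) (Icc a b) t) {t : ℝ} (ht : t ∈ Icc a b) :
    Ω t ^ 2 * (s t ^ 2 + (28 / 95) * Ω t ^ 2) ^ ((14 / 5 : ℝ))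
      = Ω a ^ 2 * (s a ^ 2 + (28 / 95) * Ω a ^ 2) ^ ((14 / 5 : ℝ)) :=
  icl_eq_of_hasDerivWithinAt_zero (fun τ hτ => hasDerivWithinAt_firstIntegral (hs τ hτ) (hΩ τ hτ)) ht

/-- **Centre swirl never switches off** along an inviscid sector solution: `Ω(a) ≠ 0 ⇒ Ω(t) ≠ 0` on `[a, b]`. -/
theorem swirl_ne_zero {s Ω : ℝ → ℝ} {a b : ℝ}
    (hs : ∀ t ∈ Icc a b, HasDerivWithinAt s (-(5 / 14) * s t ^ 2 - (2 / 5) * Ω t ^ 2) (Icc a b) t)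
    (hΩ : ∀ t ∈ Icc a b, HasDerivWithinAt Ω (s t * Ω t) (Icc a b) t) (hΩa : Ω a ≠ 0) {t : ℝ} (ht : t ∈ Icc a b) :
    Ω t ≠ 0 := by
  intro hΩt
  have hG := firstIntegral_eq hs hΩ ht
  rw [hΩt] at hG
  simp only [ne_eq, OfNat.ofNat_ne_zero, not_false_eq_true, zero_pow, zero_mul] at hG
  have hPa : 0 < s a ^ 2 + (28 / 95) * Ω a ^ 2 := by
    have : 0 < Ω a ^ 2 := by positivity
    nlinarith [sq_nonneg (s a)]
  have h1 : 0 < Ω a ^ 2 * (s a ^ 2 + (28 / 95) * Ω a ^ 2) ^ ((14 / 5 : ℝ)) :=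
    mul_pos (by positivity) (Real.rpow_pos_of_pos hPa _)
  linarith

/-- **The centre strain never increases**: `ṡ = −(5/14)s² − (2/5)Ω² ≤ 0`, so `s` is antitone on `[a, b]`. -/
theorem strain_antitoneOn {s Ω : ℝ → ℝ} {a b : ℝ}
    (hs : ∀ t ∈ Icc a b, HasDerivWithinAt s (-(5 / 14) * s t ^ 2 - (2 / 5) * Ω t ^ 2) (Icc a b) t) :
    AntitoneOn s (Icc a b) :=
  icl_antitoneOn_Icc hs fun t _ => by nlinarith [sq_nonneg (s t), sq_nonneg (Ω t)]

/-! ### §2 Finite life from compression -/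

/-- **Compression clock.**  If `(s, Ω)` solves the inviscid centre law on `[t₁, T]` and `s(t₁) < 0` (axial compression at the
centre), then `T < t₁ + 14/(5|s(t₁)|)`: no classical solution survives its Riccati time.  (With `Ω ≡ 0` the bound is attained
by `s(t) = s(t₁)/(1 + (5/14)s(t₁)(t − t₁))`.) -/
theorem time_lt_of_compression {s Ω : ℝ → ℝ} {t₁ T : ℝ} (hT : t₁ ≤ T)
    (hs : ∀ t ∈ Icc t₁ T, HasDerivWithinAt s (-(5 / 14) * s t ^ 2 - (2 / 5) * Ω t ^ 2) (Icc t₁ T) t)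
    (hneg : s t₁ < 0) : T < t₁ + 14 / (5 * |s t₁|) := by
  have hanti := icl_antitoneOn_Icc hs fun t _ => by nlinarith [sq_nonneg (s t), sq_nonneg (Ω t)]
  have ht₁ : t₁ ∈ Icc t₁ T := left_mem_Icc.2 hT
  have hTm : T ∈ Icc t₁ T := right_mem_Icc.2 hT
  have hsneg : ∀ t ∈ Icc t₁ T, s t < 0 := fun t ht => lt_of_le_of_lt (hanti ht₁ ht ht.1) hneg
  -- ψ(t) = −1/s(t) + (5/14) t is antitone
  have hψ : ∀ t ∈ Icc t₁ T, HasDerivWithinAt (fun τ => -(s τ)⁻¹ + (5 / 14) * τ)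
      (-(2 / 5) * Ω t ^ 2 / s t ^ 2) (Icc t₁ T) t := by
    intro t ht
    have hst : s t ≠ 0 := (hsneg t ht).ne
    have h := ((hs t ht).inv hst).neg.add ((hasDerivWithinAt_id t _).const_mul (5 / 14 : ℝ))
    refine h.congr_deriv ?_
    field_simp
    ring
  have hψanti := icl_antitoneOn_Icc hψ fun t ht => by
    have : 0 < s t ^ 2 := by positivity [(hsneg t ht).ne]
    exact div_nonpos_of_nonpos_of_nonneg (by nlinarith [sq_nonneg (Ω t)]) this.le
  have hcmp := hψanti ht₁ hTm hT
  -- hcmp : −1/s(T) + (5/14)T ≤ −1/s(t₁) + (5/14)t₁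
  have hsT : 0 < -(s T)⁻¹ := by
    have := hsneg T hTm
    have : (s T)⁻¹ < 0 := inv_lt_zero.2 this
    linarith
  have habs : |s t₁| = -s t₁ := abs_of_neg hneg
  rw [habs]
  have hs1 : -(s t₁)⁻¹ = 1 / (-s t₁) := by
    field_simp
  have key : (5 / 14 : ℝ) * (T - t₁) < 1 / (-s t₁) := by
    have := hcmp
    simp only at this
    linarith
  have hpos : 0 < -s t₁ := by linarith
  have : T - t₁ < 14 / (5 * (-s t₁)) := by
    rw [lt_div_iff₀ (by positivity)]
    have h14 : (5 / 14 : ℝ) * (T - t₁) * (-s t₁) < 1 := by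
      have := mul_lt_mul_of_pos_right key hpos
      rwa [one_div, inv_mul_cancel₀ hpos.ne'] at this
    nlinarith
  linarith

/-! ### §3 Finite life from swirl -/

/-- **Uniform floor for `P = s² + (28/95)Ω²` from the first integral.**  Along a solution on `[0, T]` with `Ω(0) ≠ 0`,
`((28/95)·G(0))^{5/19} ≤ s(t)² + (28/95)Ω(t)²` for all `t ∈ [0, T]`, where `G(0) = Ω(0)²(s(0)² + (28/95)Ω(0)²)^{14/5}`
(because `Ω² ≤ P/(28/95)` gives `(28/95)G = (28/95)Ω²P^{14/5} ≤ P^{19/5}`). -/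
theorem floor_of_firstIntegral {s Ω : ℝ → ℝ} {T : ℝ}
    (hs : ∀ t ∈ Icc 0 T, HasDerivWithinAt s (-(5 / 14) * s t ^ 2 - (2 / 5) * Ω t ^ 2) (Icc 0 T) t)
    (hΩ : ∀ t ∈ Icc 0 T, HasDerivWithinAt Ω (s t * Ω t) (Icc 0 T) t) {t : ℝ} (ht : t ∈ Icc 0 T) :
    ((28 / 95) * (Ω 0 ^ 2 * (s 0 ^ 2 + (28 / 95) * Ω 0 ^ 2) ^ ((14 / 5 : ℝ)))) ^ ((5 / 19 : ℝ))
      ≤ s t ^ 2 + (28 / 95) * Ω t ^ 2 := by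
  have hG := firstIntegral_eq hs hΩ ht
  set P := s t ^ 2 + (28 / 95) * Ω t ^ 2 with hPdef
  have hP : 0 ≤ P := by positivity
  have hΩP : (28 / 95) * Ω t ^ 2 ≤ P := by nlinarith [sq_nonneg (s t)]
  have h14 : 0 ≤ P ^ ((14 / 5 : ℝ)) := Real.rpow_nonneg hP _
  have hle : (28 / 95) * (Ω 0 ^ 2 * (s 0 ^ 2 + (28 / 95) * Ω 0 ^ 2) ^ ((14 / 5 : ℝ))) ≤ P ^ ((19 / 5 : ℝ)) := by
    rw [← hG]
    calc (28 / 95) * (Ω t ^ 2 * P ^ ((14 / 5 : ℝ))) = ((28 / 95) * Ω t ^ 2) * P ^ ((14 / 5 : ℝ)) := by ring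
      _ ≤ P * P ^ ((14 / 5 : ℝ)) := mul_le_mul_of_nonneg_right hΩP h14
      _ = P ^ ((19 / 5 : ℝ)) := by
          rw [← Real.rpow_one_add' hP (by norm_num)]
          norm_num
  have hc0 : 0 ≤ (28 / 95) * (Ω 0 ^ 2 * (s 0 ^ 2 + (28 / 95) * Ω 0 ^ 2) ^ ((14 / 5 : ℝ))) := by positivity
  calc ((28 / 95) * (Ω 0 ^ 2 * (s 0 ^ 2 + (28 / 95) * Ω 0 ^ 2) ^ ((14 / 5 : ℝ)))) ^ ((5 / 19 : ℝ))
      ≤ (P ^ ((19 / 5 : ℝ))) ^ ((5 / 19 : ℝ)) := Real.rpow_le_rpow hc0 hle (by norm_num)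
    _ = P := by
        rw [← Real.rpow_mul hP]
        norm_num

/-- **Swirl clock.**  If `(s, Ω)` solves the inviscid centre law on `[0, T]` and `Ω(0) ≠ 0`, then with
`G₀ = Ω(0)²(s(0)² + (28/95)Ω(0)²)^{14/5} > 0` and `δ = (5/14)·((28/95)G₀)^{5/19} > 0` one has
`T < max(0, (s(0) + 1)/δ) + 14/5`: the centre strain falls at rate `≥ δ` until it is a compression `≤ −1`, after which the
compression clock `time_lt_of_compression` runs out within `14/5`.  Together with `time_lt_of_compression`: the inviscid
rung-2 strain+swirl sector has NO global classical solution unless `Ω(0) = 0 ≤ s(0)`. -/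
theorem time_lt_of_swirl {s Ω : ℝ → ℝ} {T : ℝ} (hT : 0 ≤ T)
    (hs : ∀ t ∈ Icc 0 T, HasDerivWithinAt s (-(5 / 14) * s t ^ 2 - (2 / 5) * Ω t ^ 2) (Icc 0 T) t)
    (hΩ : ∀ t ∈ Icc 0 T, HasDerivWithinAt Ω (s t * Ω t) (Icc 0 T) t) (hΩ0 : Ω 0 ≠ 0) :
    T < max 0 ((s 0 + 1) / ((5 / 14) *
        ((28 / 95) * (Ω 0 ^ 2 * (s 0 ^ 2 + (28 / 95) * Ω 0 ^ 2) ^ ((14 / 5 : ℝ)))) ^ ((5 / 19 : ℝ)))) + 14 / 5 := by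
  set δ : ℝ := (5 / 14) *
      ((28 / 95) * (Ω 0 ^ 2 * (s 0 ^ 2 + (28 / 95) * Ω 0 ^ 2) ^ ((14 / 5 : ℝ)))) ^ ((5 / 19 : ℝ)) with hδ
  have hP0 : 0 < s 0 ^ 2 + (28 / 95) * Ω 0 ^ 2 := by
    have : 0 < Ω 0 ^ 2 := by positivity
    nlinarith [sq_nonneg (s 0)]
  have hG0 : 0 < (28 / 95) * (Ω 0 ^ 2 * (s 0 ^ 2 + (28 / 95) * Ω 0 ^ 2) ^ ((14 / 5 : ℝ))) :=
    mul_pos (by norm_num) (mul_pos (by positivity) (Real.rpow_pos_of_pos hP0 _))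
  have hδpos : 0 < δ := mul_pos (by norm_num) (Real.rpow_pos_of_pos hG0 _)
  -- uniform decay of the strain: s(t) + δ t is antitone
  have hlin : ∀ t ∈ Icc 0 T, HasDerivWithinAt (fun τ => s τ + δ * τ)
      (-(5 / 14) * s t ^ 2 - (2 / 5) * Ω t ^ 2 + δ) (Icc 0 T) t := by
    intro t ht
    have h := (hs t ht).add ((hasDerivWithinAt_id t _).const_mul δ)
    exact h.congr_deriv (by simp)
  have hanti := icl_antitoneOn_Icc hlin fun t ht => by
    have hfloor := floor_of_firstIntegral hs hΩ ht
    have : δ ≤ (5 / 14) * (s t ^ 2 + (28 / 95) * Ω t ^ 2) := by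
      rw [hδ]
      exact mul_le_mul_of_nonneg_left hfloor (by norm_num)
    nlinarith [sq_nonneg (Ω t)]
  have h0T : (0 : ℝ) ∈ Icc 0 T := left_mem_Icc.2 hT
  have hdecay : ∀ t ∈ Icc 0 T, s t ≤ s 0 - δ * t := by
    intro t ht
    have := hanti h0T ht ht.1
    simp only [mul_zero, add_zero] at this
    linarith
  -- the time by which s ≤ −1
  set t₁ : ℝ := max 0 ((s 0 + 1) / δ) with ht₁
  by_cases hcase : T < t₁
  · linarith [hcase]
  · have hcase : t₁ ≤ T := le_of_not_gt hcase
    have ht₁mem : t₁ ∈ Icc 0 T := ⟨le_max_left _ _, hcase⟩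
    have hs1 : s t₁ ≤ -1 := by
      have h1 := hdecay t₁ ht₁mem
      have h2 : (s 0 + 1) / δ ≤ t₁ := le_max_right _ _
      have h3 : s 0 + 1 ≤ δ * t₁ := by
        have := mul_le_mul_of_nonneg_left h2 hδpos.le
        rwa [mul_div_cancel₀ _ hδpos.ne'] at this
      linarith
    have hs' : ∀ t ∈ Icc t₁ T, HasDerivWithinAt s (-(5 / 14) * s t ^ 2 - (2 / 5) * Ω t ^ 2) (Icc t₁ T) t :=
      fun t ht => (hs t ⟨ht₁mem.1.trans ht.1, ht.2⟩).mono (Icc_subset_Icc ht₁mem.1 le_rfl)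
    have hclock := time_lt_of_compression hcase hs' (by linarith)
    have habs : 1 ≤ |s t₁| := by
      rw [abs_of_neg (by linarith)]
      linarith
    have h14 : 14 / (5 * |s t₁|) ≤ 14 / 5 := by
      rw [div_le_div_iff₀ (by positivity) (by norm_num)]
      nlinarith
    linarith

end Summit.NavierStokesRegularity.RungBlowupCofinalInviscidCentreLaw
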